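import Summits.AnomalousDissipation.AnomalousDissipation.Theorems.MomentParityAssembly
import Summits.AnomalousDissipation.AnomalousDissipation.Theorems.MomentParityMomentClosure
import Summits.AnomalousDissipation.AnomalousDissipation.Theorems.MomentParityGalerkinEnsembleRealization
import Summits.AnomalousDissipation.AnomalousDissipation.Theorems.MomentLadder.Negative.Clauses

/-!
# `MomentParity.MomentLadder` (stmt-AnomalousDissipation-11463): the crux implies the SUMMIT, by name

Line `Sketch`, continuation lead c4 (`--supports stmt-AnomalousDissipation-11463`). Since the previous
leads' seats the two downstream supports of route `MomentParity` have been PROVED in tree: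
`MomentClosure` (`momentClosure_proof`, stmt-11467) and `GalerkinEnsembleRealization`
(`MomentParity.galerkinEnsembleRealization_of`, stmt-11466). Together with the proved `Assembly`
(`momentParity_assembly_proof`, stmt-11469: `MomentLadder → MomentClosure → GalerkinEnsembleRealization →
AnomalousDissipation`) the crux `X = MomentLadder` now implies the summit statement
`_root_.AnomalousDissipation = Literature.Turb.ZerothLaw` UNCONDITIONALLY. This file records that edge by
name, its contrapositive (a refutation of the summit refutes the crux), and the quantitative one-viscosity
form the other routes can call: ladder witnesses of `(f, E, ε)` at ONE viscosity `ν` (for infinitely many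
levels, every order) are shadowed by ONE global Leray–Hopf solution of `NS_ν` forced by `f` with
`meanEnergy ≤ M(f, E, ε)` (`M` independent of `ν`) and `meanDissipation ≥ ε / 2`.

Net logical position of the crux after this file (all edges landed by name):
`GalerkinSteadyZerothLaw → MomentLadder`, `T_res ↔ MomentLadder ↔ C⁺ ↔ limitEnergyEq`,
`MomentLadder → GalerkinInvariantLoud` (stmt-14283), `MomentLadder → QuarticGate` (stmt-11464),
`MomentLadder → Ensemble.EnsembleZerothLawSomeForce` (stmt-0214), and now
`MomentLadder → AnomalousDissipation` (the summit).
-/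

-- `Summit.<Summit>.<Problem>` is the tree's mandated summit-side namespace (CONVENTIONS §2); for this
-- single-conjunct summit the two coincide, so the duplicate is deliberate.
set_option linter.dupNamespace false

noncomputable section

namespace Summit.AnomalousDissipation.AnomalousDissipation.Theorems.MomentLadder

open MeasureTheory Filter Topology
open Literature.Analysis.FunctionSpaces Literature.Analysis.FluidPDE
open Summit.AnomalousDissipation.AnomalousDissipation.Theses.MomentParity
open Summit.AnomalousDissipation.AnomalousDissipation.Theorems.MomentLadder.Negative

/-- **Ladder witnesses at one viscosity are realised by one loud Leray–Hopf path.** For a smooth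
divergence-free mean-zero force `f` and budgets `E`, `ε > 0` there is `M = M(f, E, ε)` such that at EVERY
viscosity `ν > 0`: if for some radius `R` and schedule `κ`, for infinitely many levels `N` and every order
`d`, there is a ladder witness `IsLadderWitness f ν N E ε R κ d μ`, then one global Leray–Hopf solution of
the Navier–Stokes equations with viscosity `ν` forced by `f` has `meanEnergy ≤ M` and
`meanDissipation ≥ ε / 2`. Composition of the proved route supports `MomentClosure` (all orders ⇒ one
Galerkin-invariant law per level) and `GalerkinEnsembleRealization` (Vishik–Fursikov limit + Birkhoff +
Chebyshev). [route AnomalousDissipation/MomentParity; FMRT2001; doi:10.1137/130931631] -/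
theorem exists_bound_lerayHopf_of_ladderWitnesses
    {f : UnitAddTorus (Fin 3) → EuclideanSpace ℝ (Fin 3)}
    (hfs : Torus.IsSmooth f) (hfd : Torus.IsDivFree f) (hfz : Torus.HasZeroMean f)
    (E : ℝ) {ε : ℝ} (hε : 0 < ε) :
    ∃ M : ℝ, ∀ ν : ℝ, 0 < ν → ∀ (R : ℝ) (κ : ℕ → ℕ),
      (∃ᶠ N in atTop, ∀ d : ℕ, ∃ μ : Measure (Torus.energySpace (Fin 3)),
          IsLadderWitness f ν N E ε R κ d μ) →
        ∃ (u₀ : UnitAddTorus (Fin 3) → EuclideanSpace ℝ (Fin 3))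
          (u : ℝ → UnitAddTorus (Fin 3) → EuclideanSpace ℝ (Fin 3)),
          Torus.IsGlobalLerayHopf ν (fun _ => f) u₀ u ∧ meanEnergy u ≤ M ∧
            ε / 2 ≤ meanDissipation ν u := by
  obtain ⟨M, hM⟩ := MomentParity.galerkinEnsembleRealization_of f hfs hfd hfz E ε hε
  refine ⟨M, fun ν hν R κ hfreq => hM ν hν R κ (hfreq.mono fun N hN => ?_)⟩
  exact momentClosure_proof f hfs hfd hfz ν N E ε R κ hν hN

/-- **The crux implies the summit**: `MomentLadder → AnomalousDissipation` (= `Literature.Turb.ZerothLaw`: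
a smooth steady force, `ν_j → 0`, global Leray–Hopf solutions with bounded mean energy and mean
dissipation bounded below). The proved `Assembly` (stmt-11469) fed with the proved supports
`MomentClosure` (stmt-11467) and `GalerkinEnsembleRealization` (stmt-11466).
[route AnomalousDissipation/MomentParity] -/
theorem anomalousDissipation_of_MomentLadder : MomentLadder → _root_.AnomalousDissipation :=
  fun h => momentParity_assembly_proof h momentClosure_proof MomentParity.galerkinEnsembleRealization_of

/-- The same edge with the summit unfolded to its Literature name `Literature.Turb.ZerothLaw`.
[route AnomalousDissipation/MomentParity] -/
theorem zerothLaw_of_MomentLadder (h : MomentLadder) : Literature.Turb.ZerothLaw :=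
  anomalousDissipation_of_MomentLadder h

/-- Contrapositive, for the Negative lane: a refutation of the summit statement refutes the crux.
[route AnomalousDissipation/MomentParity] -/
theorem not_MomentLadder_of_not_anomalousDissipation (h : ¬ _root_.AnomalousDissipation) :
    ¬ MomentLadder :=
  fun hL => h (anomalousDissipation_of_MomentLadder hL)

end Summit.AnomalousDissipation.AnomalousDissipation.Theorems.MomentLadder

end
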